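import Summits.KontsevichZagierPeriods.KontsevichZagierPeriods.Theorems.LinRedNormalFormArrangementNormalFormSeparateTwoHIAway
import Summits.KontsevichZagierPeriods.KontsevichZagierPeriods.Theorems.LinRedNormalFormArrangementNormalFormSeparateTwoHICover
import Summits.KontsevichZagierPeriods.KontsevichZagierPeriods.Theorems.LinRedNormalFormArrangementNormalFormSeparateTwoZeroChart
import Summits.KontsevichZagierPeriods.KontsevichZagierPeriods.Theorems.LinRedNormalFormArrangementNormalFormSeparateTwoZeroWeights

/-!
# Termwise convergence of the Taylor split: the local theorem at a base point

(Line `janus-bands`, crux `ArrangementNormalForm`, stub `stub_separateTwoPos_hI`, part `HILocal`.)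
On the base plane, let `Y = {∀ j, 0 < M_j}` be the open polygon, `m = lmass ∘ av` the fibre mass,
`R = P/(∏ L_j^{e_j} λ^n)` the base factor of the integrand (`λ = y − (l₁ x + l₂)`) and
`Ri i = q_i λ^i/(∏ L_j^{e_j} λ^n)` those of the Taylor pieces. If `∫⁻_Y |R| m < ∞`, no active
letter is identically zero, and at the point `x₁` every vanishing active letter forces `x₁` onto
the pole line (hypothesis `hH` of the stub), then the density `g = 𝟙_Y (∑_{i<N} |Ri i|) m` is
finite on a neighbourhood of `x₁` (`local_finite`, registered as `separateTwo_hiLocal`).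
Proof: real Taylor data and wall factorisation at `x₁` (`SepTwoZero.exists_coeff_data`,
`SepTwoZero.wall_factor`), the sign lemma in the form `eventually_inside_or_outside`, the sector
theorems of parts `HIPole` (on the pole line) / `HIAway` (off it) for all small scales
(`*_ev`), and the covering lemma `SepTwo.cover_nhds` of part `HICover` for the measure
`volume.withDensity g`.
-/

noncomputable section

open Set MeasureTheory Filter Topology
open scoped ENNReal

namespace Summit.KontsevichZagierPeriods.ArrangementNormalForm.JanusBands

namespace SepTwo

/-! ### Filters -/

/-- Pulling back a doubly-eventual statement along `δ ↦ 4δ`, `ε ↦ 4ε`. -/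
theorem eventually_four {D : ℝ → ℝ → Prop}
    (h : ∀ᶠ δ in 𝓝[>] (0 : ℝ), ∀ᶠ ε in 𝓝[>] (0 : ℝ), D δ ε) :
    ∀ᶠ δ in 𝓝[>] (0 : ℝ), ∀ᶠ ε in 𝓝[>] (0 : ℝ), D (4 * δ) (4 * ε) := by
  have h4 : Tendsto (fun δ : ℝ => 4 * δ) (𝓝[>] 0) (𝓝[>] 0) := by
    refine tendsto_nhdsWithin_iff.2 ⟨?_, ?_⟩
    · exact ((continuous_const.mul continuous_id).tendsto' 0 0 (by simp)).mono_left
        nhdsWithin_le_nhds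
    · filter_upwards [self_mem_nhdsWithin] with δ hδ
      exact mem_Ioi.2 (by have := mem_Ioi.1 hδ; positivity)
  exact h4.eventually (h.mono fun δ hδ => h4.eventually hδ)

/-- Extracting one scale from four doubly-eventual statements. -/
theorem exists_of_eventually₄ {A B C D : ℝ → ℝ → Prop}
    (hA : ∀ᶠ δ in 𝓝[>] (0 : ℝ), ∀ᶠ ε in 𝓝[>] (0 : ℝ), A δ ε)
    (hB : ∀ᶠ δ in 𝓝[>] (0 : ℝ), ∀ᶠ ε in 𝓝[>] (0 : ℝ), B δ ε)
    (hC : ∀ᶠ δ in 𝓝[>] (0 : ℝ), ∀ᶠ ε in 𝓝[>] (0 : ℝ), C δ ε)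
    (hD : ∀ᶠ δ in 𝓝[>] (0 : ℝ), ∀ᶠ ε in 𝓝[>] (0 : ℝ), D δ ε) :
    ∃ δ > 0, ∃ ε > 0, A δ ε ∧ B δ ε ∧ C δ ε ∧ D δ ε := by
  obtain ⟨δ, hδ0, ⟨hA', hB'⟩, hC', hD'⟩ :=
    ((eventually_mem_nhdsWithin (a := (0 : ℝ)) (s := Ioi 0)).and ((hA.and hB).and (hC.and hD))).exists
  obtain ⟨ε, hε0, ⟨hA'', hB''⟩, hC'', hD''⟩ :=
    ((eventually_mem_nhdsWithin (a := (0 : ℝ)) (s := Ioi 0)).and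
      ((hA'.and hB').and (hC'.and hD'))).exists
  exact ⟨δ, mem_Ioi.1 hδ0, ε, mem_Ioi.1 hε0, hA'', hB'', hC'', hD''⟩

/-- **The sign lemma along a thin sector:** for all small scales the open sector at scale
`(4δ, 4ε)` lies inside the base polygon or misses it. -/
theorem eventually_inside_or_outside {m' : ℕ} (M : Fin m' → Atm 2) (x₁ P Q : Fin 2 → ℝ) :
    ∀ᶠ δ in 𝓝[>] (0 : ℝ), ∀ᶠ ε in 𝓝[>] (0 : ℝ),
      (∀ t ∈ Ioo (0 : ℝ) (4 * δ), ∀ v ∈ Ioo (0 : ℝ) (4 * ε),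
          bpt x₁ P Q t v ∈ {x : Fin 2 → ℝ | ∀ j, 0 < av x (M j)}) ∨
        (∀ t ∈ Ioo (0 : ℝ) (4 * δ), ∀ v ∈ Ioo (0 : ℝ) (4 * ε),
          bpt x₁ P Q t v ∉ {x : Fin 2 → ℝ | ∀ j, 0 < av x (M j)}) := by
  have h := eventually_four (eventually_sign (fun j => av x₁ (M j))
    (fun j => ∑ i, ((M j).1 i : ℝ) * P i) (fun j => ∑ i, ((M j).1 i : ℝ) * Q i))
  refine h.mono fun δ hδ => hδ.mono fun ε hε => ?_
  rcases hε with hpos | ⟨j, hj⟩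
  · refine Or.inl fun t ht v hv j => ?_
    show 0 < av (bpt x₁ P Q t v) (M j)
    rw [av_bpt]
    linarith [hpos t ht v hv j]
  · refine Or.inr fun t ht v hv hmem => ?_
    have h1 : 0 < av (bpt x₁ P Q t v) (M j) := hmem j
    rw [av_bpt] at h1
    linarith [hj t ht v hv]

/-! ### The sector theorems for all small scales -/

section Ev

variable {k m' : ℕ} (M : Fin m' → Atm 2) (lo hi : Fin k → Fin k ⊕ Atm 2)
  (a : Fin k → Option (Atm 2)) (N N' : ℕ) (cc : ℕ × ℕ → ℝ) (E n : ℕ) (W₁ : ℝ → ℝ)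
  (l₁ l₂ : ℝ) (x₁ : Fin 2 → ℝ) (R : (Fin 2 → ℝ) → ℝ) (Ri : ℕ → (Fin 2 → ℝ) → ℝ)

/-- Sectors of finite slope at a pole point, all small scales. -/
theorem hsector_pole_ev (hlam : x₁ 1 - (l₁ * x₁ 0 + l₂) = 0)
    (hR : ∀ x, R x = (∑ i ∈ Finset.range N, (∑ m ∈ Finset.range N', cc (i, m) * (x 0 - x₁ 0) ^ m) *
      (x 1 - (l₁ * x 0 + l₂)) ^ i) / ((x 0 - x₁ 0) ^ E * W₁ (x 0 - x₁ 0) * (x 1 - (l₁ * x 0 + l₂)) ^ n))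
    (hRi : ∀ i ∈ Finset.range N, ∀ x, Ri i x = (∑ m ∈ Finset.range N', cc (i, m) * (x 0 - x₁ 0) ^ m) *
      (x 1 - (l₁ * x 0 + l₂)) ^ i / ((x 0 - x₁ 0) ^ E * W₁ (x 0 - x₁ 0) * (x 1 - (l₁ * x 0 + l₂)) ^ n))
    (hRm : Measurable R) (hRim : ∀ i, Measurable (Ri i)) (hW₁c : Continuous W₁) (hW₁0 : W₁ 0 ≠ 0)
    {ρW CW : ℝ} (hρW : 0 < ρW) (hWb : ∀ u : ℝ, |u| < ρW → |W₁ 0| / 2 ≤ |W₁ u| ∧ |W₁ u| ≤ CW)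
    (hfinY : ∫⁻ x in {x | ∀ j, 0 < av x (M j)}, ENNReal.ofReal |R x| * lmass lo hi a (av x) < ∞)
    {P₀ s σ : ℝ} (hP₀ : P₀ ≠ 0) (hσ : |σ| = 1) (hs : s = 0 ∨ (s ≠ 0 ∧ |s| ≤ 2))
    (P Q : Fin 2 → ℝ) (hP : P = ![P₀, P₀ * l₁ + s]) (hQ : Q = ![0, σ]) :
    ∀ᶠ δ in 𝓝[>] (0 : ℝ), ∀ᶠ ε in 𝓝[>] (0 : ℝ),
      ∫⁻ z in sector x₁ P Q δ (Ico 0 ε), {x : Fin 2 → ℝ | ∀ j, 0 < av x (M j)}.indicator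
        (fun x => (∑ i ∈ Finset.range N, ENNReal.ofReal |Ri i x|) * lmass lo hi a (av x)) z < ∞ := by
  obtain ⟨δ₀, hδ₀, ε₀, hε₀, KΛ, hKΛ, Kn, CΛ, hCΛ, hmono, hang, -⟩ := weight_hyps lo hi a x₁ P Q
  have hsign := eventually_inside_or_outside M x₁ P Q
  have hcδ : 0 < min (min (δ₀ / 4) (ρW / (4 * |P₀|))) (1 / 4) := by
    have := abs_pos.2 hP₀; positivity
  set cε : ℝ := if s = 0 then 1 else |s| / 8 with hcε_def
  have hcε0 : 0 < cε := by
    rw [hcε_def]; split_ifs with h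
    · exact one_pos
    · have := abs_pos.2 h; positivity
  have hcε : 0 < min (min (ε₀ / 4) (1 / 4)) cε := by positivity
  filter_upwards [hsign, Ioo_mem_nhdsGT hcδ] with δ hsδ hδ
  filter_upwards [hsδ, Ioo_mem_nhdsGT hcε] with ε hsε hε
  obtain ⟨hδa, hδ1⟩ := lt_min_iff.1 hδ.2
  obtain ⟨hδ0, hδW⟩ := lt_min_iff.1 hδa
  obtain ⟨hεa, hεs⟩ := lt_min_iff.1 hε.2
  obtain ⟨hε0, hε1⟩ := lt_min_iff.1 hεa
  have hδW' : 4 * δ * |P₀| ≤ ρW := by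
    have h := (lt_div_iff₀ (by have := abs_pos.2 hP₀; positivity)).1 hδW
    linarith
  have hεs' : s ≠ 0 → 4 * ε ≤ |s| / 2 := fun h => by
    rw [hcε_def, if_neg h] at hεs; linarith
  exact hsector_pole M lo hi a N N' cc E n W₁ l₁ l₂ x₁ R Ri hlam hR hRi hRm hRim hW₁c hW₁0 hWb hfinY
    hP₀ hσ hs P Q hP hQ hKΛ hCΛ hmono hang hδ.1 hε.1 (by linarith) (by linarith) hδW' (by linarith)
    (by linarith) hεs' hsε

/-- Vertical sectors at a pole point, all small scales. -/
theorem vsector_pole_ev (hlam : x₁ 1 - (l₁ * x₁ 0 + l₂) = 0)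
    (hR : ∀ x, R x = (∑ i ∈ Finset.range N, (∑ m ∈ Finset.range N', cc (i, m) * (x 0 - x₁ 0) ^ m) *
      (x 1 - (l₁ * x 0 + l₂)) ^ i) / ((x 0 - x₁ 0) ^ E * W₁ (x 0 - x₁ 0) * (x 1 - (l₁ * x 0 + l₂)) ^ n))
    (hRi : ∀ i ∈ Finset.range N, ∀ x, Ri i x = (∑ m ∈ Finset.range N', cc (i, m) * (x 0 - x₁ 0) ^ m) *
      (x 1 - (l₁ * x 0 + l₂)) ^ i / ((x 0 - x₁ 0) ^ E * W₁ (x 0 - x₁ 0) * (x 1 - (l₁ * x 0 + l₂)) ^ n))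
    (hRm : Measurable R) (hRim : ∀ i, Measurable (Ri i)) (hW₁c : Continuous W₁) (hW₁0 : W₁ 0 ≠ 0)
    {ρW CW : ℝ} (hρW : 0 < ρW) (hWb : ∀ u : ℝ, |u| < ρW → |W₁ 0| / 2 ≤ |W₁ u| ∧ |W₁ u| ≤ CW)
    (hfinY : ∫⁻ x in {x | ∀ j, 0 < av x (M j)}, ENNReal.ofReal |R x| * lmass lo hi a (av x) < ∞)
    {p q₀ : ℝ} (hp : |p| = 1) (hq₀ : |q₀| = 1)
    (P Q : Fin 2 → ℝ) (hP : P = ![0, p]) (hQ : Q = ![q₀, q₀ * l₁]) :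
    ∀ᶠ δ in 𝓝[>] (0 : ℝ), ∀ᶠ ε in 𝓝[>] (0 : ℝ),
      ∫⁻ z in sector x₁ P Q δ (Ico 0 ε), {x : Fin 2 → ℝ | ∀ j, 0 < av x (M j)}.indicator
        (fun x => (∑ i ∈ Finset.range N, ENNReal.ofReal |Ri i x|) * lmass lo hi a (av x)) z < ∞ := by
  obtain ⟨δ₀, hδ₀, ε₀, hε₀, KΛ, hKΛ, Kn, CΛ, -, hmono, -, -⟩ := weight_hyps lo hi a x₁ P Q
  have hsign := eventually_inside_or_outside M x₁ P Q
  have hcδ : 0 < min (δ₀ / 4) (1 / 4) := by positivity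
  have hcε : 0 < min (ε₀ / 4) (ρW / 4) := by positivity
  filter_upwards [hsign, Ioo_mem_nhdsGT hcδ] with δ hsδ hδ
  filter_upwards [hsδ, Ioo_mem_nhdsGT hcε] with ε hsε hε
  obtain ⟨hδ0, hδ1⟩ := lt_min_iff.1 hδ.2
  obtain ⟨hε0, hεW⟩ := lt_min_iff.1 hε.2
  exact vsector_pole M lo hi a N N' cc E n W₁ l₁ l₂ x₁ R Ri hlam hR hRi hRm hRim hW₁c hW₁0 hWb hfinY
    hp hq₀ P Q hP hQ hKΛ hmono hδ.1 hε.1 (by linarith) (by linarith) (by linarith) (by linarith) hsε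

/-- Sectors of finite slope off the pole line, all small scales. -/
theorem hsector_away_ev (hlam : x₁ 1 - (l₁ * x₁ 0 + l₂) ≠ 0)
    (hcc : ∃ im ∈ Finset.range N ×ˢ Finset.range N', cc im ≠ 0)
    (hR : ∀ x, R x = (∑ i ∈ Finset.range N, (∑ m ∈ Finset.range N', cc (i, m) * (x 0 - x₁ 0) ^ m) *
      (x 1 - (l₁ * x 0 + l₂)) ^ i) / (W₁ (x 0 - x₁ 0) * (x 1 - (l₁ * x 0 + l₂)) ^ n))
    (hRi : ∀ i ∈ Finset.range N, ∀ x, Ri i x = (∑ m ∈ Finset.range N', cc (i, m) * (x 0 - x₁ 0) ^ m) *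
      (x 1 - (l₁ * x 0 + l₂)) ^ i / (W₁ (x 0 - x₁ 0) * (x 1 - (l₁ * x 0 + l₂)) ^ n))
    (hRm : Measurable R) (hRim : ∀ i, Measurable (Ri i)) (hW₁c : Continuous W₁) (hW₁0 : W₁ 0 ≠ 0)
    {ρW CW : ℝ} (hρW : 0 < ρW) (hρW1 : ρW ≤ 1)
    (hWb : ∀ u : ℝ, |u| < ρW → |W₁ 0| / 2 ≤ |W₁ u| ∧ |W₁ u| ≤ CW)
    (hfinY : ∫⁻ x in {x | ∀ j, 0 < av x (M j)}, ENNReal.ofReal |R x| * lmass lo hi a (av x) < ∞)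
    {P₀ s σ : ℝ} (hP₀ : P₀ ≠ 0) (hσ : |σ| = 1)
    (P Q : Fin 2 → ℝ) (hP : P = ![P₀, P₀ * l₁ + s]) (hQ : Q = ![0, σ]) :
    ∀ᶠ δ in 𝓝[>] (0 : ℝ), ∀ᶠ ε in 𝓝[>] (0 : ℝ),
      ∫⁻ z in sector x₁ P Q δ (Ico 0 ε), {x : Fin 2 → ℝ | ∀ j, 0 < av x (M j)}.indicator
        (fun x => (∑ i ∈ Finset.range N, ENNReal.ofReal |Ri i x|) * lmass lo hi a (av x)) z < ∞ := by
  obtain ⟨δ₀, hδ₀, ε₀, hε₀, KΛ, hKΛ, Kn, CΛ, hCΛ, hmono, hang, hrad⟩ := weight_hyps lo hi a x₁ P Q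
  have hsign := eventually_inside_or_outside M x₁ P Q
  have hl : 0 < |x₁ 1 - (l₁ * x₁ 0 + l₂)| := abs_pos.2 hlam
  have hcδ : 0 < min (min (δ₀ / 4) (ρW / (4 * |P₀|))) (|x₁ 1 - (l₁ * x₁ 0 + l₂)| / (8 * (|s| + 1))) := by
    have := abs_pos.2 hP₀; positivity
  have hcε : 0 < min (ε₀ / 4) (1 / 4) := by positivity
  filter_upwards [hsign, Ioo_mem_nhdsGT hcδ] with δ hsδ hδ
  filter_upwards [hsδ, Ioo_mem_nhdsGT hcε] with ε hsε hε
  obtain ⟨hδa, hδl⟩ := lt_min_iff.1 hδ.2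
  obtain ⟨hδ0, hδW⟩ := lt_min_iff.1 hδa
  obtain ⟨hε0, hε1⟩ := lt_min_iff.1 hε.2
  have hδW' : 4 * δ * |P₀| ≤ ρW := by
    have h := (lt_div_iff₀ (by have := abs_pos.2 hP₀; positivity)).1 hδW
    linarith
  have hδl' : 4 * δ * (|s| + 1) ≤ |x₁ 1 - (l₁ * x₁ 0 + l₂)| / 2 := by
    have h := (lt_div_iff₀ (by positivity)).1 hδl
    linarith
  exact hsector_away M lo hi a N N' cc n W₁ l₁ l₂ x₁ R Ri hlam hcc hR hRi hRm hRim hW₁c hW₁0 hρW1 hWb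
    hfinY hP₀ hσ P Q hP hQ hKΛ hCΛ hmono hang hrad hδ.1 hε.1 (by linarith) (by linarith) hδW'
    (by linarith) hδl' hsε

/-- Vertical sectors off the pole line, all small scales. -/
theorem vsector_away_ev (hlam : x₁ 1 - (l₁ * x₁ 0 + l₂) ≠ 0)
    (hcc : ∃ im ∈ Finset.range N ×ˢ Finset.range N', cc im ≠ 0)
    (hR : ∀ x, R x = (∑ i ∈ Finset.range N, (∑ m ∈ Finset.range N', cc (i, m) * (x 0 - x₁ 0) ^ m) *
      (x 1 - (l₁ * x 0 + l₂)) ^ i) / (W₁ (x 0 - x₁ 0) * (x 1 - (l₁ * x 0 + l₂)) ^ n))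
    (hRi : ∀ i ∈ Finset.range N, ∀ x, Ri i x = (∑ m ∈ Finset.range N', cc (i, m) * (x 0 - x₁ 0) ^ m) *
      (x 1 - (l₁ * x 0 + l₂)) ^ i / (W₁ (x 0 - x₁ 0) * (x 1 - (l₁ * x 0 + l₂)) ^ n))
    (hRm : Measurable R) (hRim : ∀ i, Measurable (Ri i)) (hW₁c : Continuous W₁) (hW₁0 : W₁ 0 ≠ 0)
    {ρW CW : ℝ} (hρW : 0 < ρW) (hρW1 : ρW ≤ 1)
    (hWb : ∀ u : ℝ, |u| < ρW → |W₁ 0| / 2 ≤ |W₁ u| ∧ |W₁ u| ≤ CW)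
    (hfinY : ∫⁻ x in {x | ∀ j, 0 < av x (M j)}, ENNReal.ofReal |R x| * lmass lo hi a (av x) < ∞)
    {p q₀ : ℝ} (hp : |p| = 1) (hq₀ : |q₀| = 1)
    (P Q : Fin 2 → ℝ) (hP : P = ![0, p]) (hQ : Q = ![q₀, q₀ * l₁]) :
    ∀ᶠ δ in 𝓝[>] (0 : ℝ), ∀ᶠ ε in 𝓝[>] (0 : ℝ),
      ∫⁻ z in sector x₁ P Q δ (Ico 0 ε), {x : Fin 2 → ℝ | ∀ j, 0 < av x (M j)}.indicator
        (fun x => (∑ i ∈ Finset.range N, ENNReal.ofReal |Ri i x|) * lmass lo hi a (av x)) z < ∞ := by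
  obtain ⟨δ₀, hδ₀, ε₀, hε₀, KΛ, hKΛ, Kn, CΛ, hCΛ, hmono, hang, hrad⟩ := weight_hyps lo hi a x₁ P Q
  have hsign := eventually_inside_or_outside M x₁ P Q
  have hl : 0 < |x₁ 1 - (l₁ * x₁ 0 + l₂)| := abs_pos.2 hlam
  have hcδ : 0 < min (min (δ₀ / 4) (1 / 4)) (|x₁ 1 - (l₁ * x₁ 0 + l₂)| / 8) := by positivity
  have hcε : 0 < min (ε₀ / 4) (ρW / 4) := by positivity
  filter_upwards [hsign, Ioo_mem_nhdsGT hcδ] with δ hsδ hδ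
  filter_upwards [hsδ, Ioo_mem_nhdsGT hcε] with ε hsε hε
  obtain ⟨hδa, hδl⟩ := lt_min_iff.1 hδ.2
  obtain ⟨hδ0, hδ1⟩ := lt_min_iff.1 hδa
  obtain ⟨hε0, hεW⟩ := lt_min_iff.1 hε.2
  exact vsector_away M lo hi a N N' cc n W₁ l₁ l₂ x₁ R Ri hlam hcc hR hRi hRm hRim hW₁c hW₁0 hρW1 hWb
    hfinY hp hq₀ P Q hP hQ hKΛ hCΛ hmono hang hrad hδ.1 hε.1 (by linarith) (by linarith)
    (by linarith) (by linarith) (by linarith) hsε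

end Ev

/-! ### The local theorem -/

/-- **Local finiteness of the density at a base point.** See the module docstring. -/
theorem local_finite {k m m' : ℕ} (M : Fin m' → Atm 2) (lo hi : Fin k → Fin k ⊕ Atm 2)
    (a : Fin k → Option (Atm 2)) (κ μ : Fin m → ℝ) (e : Fin m → ℕ) (n : ℕ) (l₁ l₂ : ℝ)
    (N : ℕ) (q : ℕ → MvPolynomial (Fin 1) ℚ) (R : (Fin 2 → ℝ) → ℝ) (Ri : ℕ → (Fin 2 → ℝ) → ℝ)
    (hR : ∀ x, R x = (∑ i ∈ Finset.range N, MvPolynomial.aeval (fun _ : Fin 1 => x 0) (q i) *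
      (x 1 - (l₁ * x 0 + l₂)) ^ i) / ((∏ j, (κ j * x 0 + μ j) ^ e j) * (x 1 - (l₁ * x 0 + l₂)) ^ n))
    (hRi : ∀ i ∈ Finset.range N, ∀ x, Ri i x = MvPolynomial.aeval (fun _ : Fin 1 => x 0) (q i) *
      (x 1 - (l₁ * x 0 + l₂)) ^ i / ((∏ j, (κ j * x 0 + μ j) ^ e j) * (x 1 - (l₁ * x 0 + l₂)) ^ n))
    (hRm : Measurable R) (hRim : ∀ i, Measurable (Ri i))
    (hκ : ∀ j, e j ≠ 0 → κ j = 0 → μ j ≠ 0)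
    (hfinY : ∫⁻ x in {x | ∀ j, 0 < av x (M j)}, ENNReal.ofReal |R x| * lmass lo hi a (av x) < ∞)
    (x₁ : Fin 2 → ℝ) (hH : ∀ j, e j ≠ 0 → κ j * x₁ 0 + μ j = 0 → x₁ 1 - (l₁ * x₁ 0 + l₂) = 0) :
    ∃ V : Set (Fin 2 → ℝ), IsOpen V ∧ x₁ ∈ V ∧
      ∫⁻ z in V, {x : Fin 2 → ℝ | ∀ j, 0 < av x (M j)}.indicator
        (fun x => (∑ i ∈ Finset.range N, ENNReal.ofReal |Ri i x|) * lmass lo hi a (av x)) z < ∞ := by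
  classical
  set g : (Fin 2 → ℝ) → ℝ≥0∞ := fun z => {x : Fin 2 → ℝ | ∀ j, 0 < av x (M j)}.indicator
    (fun x => (∑ i ∈ Finset.range N, ENNReal.ofReal |Ri i x|) * lmass lo hi a (av x)) z with hg
  -- real Taylor data of the coefficients at `x₁ 0`
  obtain ⟨N', cc, Qf, hQ, hQq⟩ := SepTwoZero.exists_coeff_data N q (x₁ 0)
  have hq' : ∀ i ∈ Finset.range N, ∀ x : Fin 2 → ℝ, MvPolynomial.aeval (fun _ : Fin 1 => x 0) (q i) =
      ∑ m ∈ Finset.range N', cc (i, m) * (x 0 - x₁ 0) ^ m := by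
    intro i hi x
    have hx : (fun _ : Fin 1 => x 0) = fun _ => x₁ 0 + (x 0 - x₁ 0) := by funext; ring
    rw [hx, ← hQq i (Finset.mem_range.1 hi), hQ]
  -- degenerate case: all coefficients vanish
  by_cases hcc : ∃ im ∈ Finset.range N ×ˢ Finset.range N', cc im ≠ 0
  swap
  · push Not at hcc
    have hRi0 : ∀ i ∈ Finset.range N, ∀ x, Ri i x = 0 := fun i hi x => by
      rw [hRi i hi, hq' i hi, inner_eq_zero cc N N' hcc i (Finset.mem_range.1 hi), zero_mul, zero_div]
    refine ⟨univ, isOpen_univ, mem_univ _, ?_⟩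
    have hg0 : g = fun _ => 0 := by
      funext z
      refine indicator_apply_eq_zero.2 fun _ => ?_
      rw [Finset.sum_eq_zero fun i hi => by rw [hRi0 i hi z, abs_zero, ENNReal.ofReal_zero], zero_mul]
    rw [hg0, lintegral_zero]
    exact ENNReal.zero_lt_top
  -- wall factorisation at `x₁ 0`
  obtain ⟨E, W₁, hW₁c, hW₁0, hEj, hfac⟩ := SepTwoZero.wall_factor κ μ e (x₁ 0) fun j h0 he hk =>
    hκ j he hk (by rw [hk, zero_mul, zero_add] at h0; exact h0)
  have hW : ∀ x : Fin 2 → ℝ, ∏ j, (κ j * x 0 + μ j) ^ e j = (x 0 - x₁ 0) ^ E * W₁ (x 0 - x₁ 0) := by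
    intro x
    have h := hfac (x 0 - x₁ 0)
    have hx : x₁ 0 + (x 0 - x₁ 0) = x 0 := by ring
    rw [hx] at h
    exact h
  obtain ⟨ρW, hρW, CW, -, hρW1, hWb⟩ := SepTwoZero.W_bounds hW₁c hW₁0
  have hR' : ∀ x, R x = (∑ i ∈ Finset.range N, (∑ m ∈ Finset.range N', cc (i, m) * (x 0 - x₁ 0) ^ m) *
      (x 1 - (l₁ * x 0 + l₂)) ^ i) / ((x 0 - x₁ 0) ^ E * W₁ (x 0 - x₁ 0) * (x 1 - (l₁ * x 0 + l₂)) ^ n) :=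
    fun x => by rw [hR, hW, Finset.sum_congr rfl fun i hi => by rw [hq' i hi]]
  have hRi' : ∀ i ∈ Finset.range N, ∀ x, Ri i x = (∑ m ∈ Finset.range N', cc (i, m) * (x 0 - x₁ 0) ^ m) *
      (x 1 - (l₁ * x 0 + l₂)) ^ i / ((x 0 - x₁ 0) ^ E * W₁ (x 0 - x₁ 0) * (x 1 - (l₁ * x 0 + l₂)) ^ n) :=
    fun i hi x => by rw [hRi i hi, hq' i hi, hW]
  -- the measure with density `g`
  set ν : Measure (Fin 2 → ℝ) := volume.withDensity g with hν_def
  have hν : ∀ S, ν S = ∫⁻ z in S, g z := fun S => withDensity_apply' g S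
  have hν0 : ν {x₁} = 0 := withDensity_absolutelyContinuous volume g (measure_singleton x₁)
  have hpm : ∀ x : ℝ, |x| = 1 → x = 1 ∨ x = -1 := fun x hx => (abs_eq zero_le_one).1 hx
  have h1 : |(1 : ℝ)| = 1 := abs_one
  have hm1 : |(-1 : ℝ)| = 1 := by simp
  -- conclusion from the sector theorems
  suffices hsec : (∀ p q : ℝ, |p| = 1 → |q| = 1 → ∀ᶠ δ in 𝓝[>] (0 : ℝ), ∀ᶠ ε in 𝓝[>] (0 : ℝ),
      ∫⁻ z in sector x₁ ![0, p] ![q, q * l₁] δ (Ico 0 ε), g z < ∞) ∧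
      (∀ r : ℝ, ∃ ρ > 0, ∀ o σ : ℝ, |o| = 1 → |σ| = 1 → ∀ᶠ δ in 𝓝[>] (0 : ℝ), ∀ᶠ ε in 𝓝[>] (0 : ℝ),
        ∫⁻ z in sector x₁ ![o * ρ, o * ρ * (l₁ + r)] ![0, σ] δ (Ico 0 ε), g z < ∞) by
    obtain ⟨hVs, hHs⟩ := hsec
    obtain ⟨δV, hδV, εV, hεV, hA, hB, hC, hD⟩ := exists_of_eventually₄ (hVs 1 1 h1 h1)
      (hVs 1 (-1) h1 hm1) (hVs (-1) 1 hm1 h1) (hVs (-1) (-1) hm1 hm1)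
    have hV : ∀ p q : ℝ, |p| = 1 → |q| = 1 → ν (sector x₁ ![0, p] ![q, q * l₁] δV (Ico 0 εV)) < ∞ := by
      intro p q hp hq
      rw [hν]
      rcases hpm p hp with rfl | rfl <;> rcases hpm q hq with rfl | rfl
      exacts [hA, hB, hC, hD]
    have hHor : ∀ r : ℝ, ∃ ρ > 0, ∃ δ > 0, ∃ ε > 0, ∀ o σ : ℝ, |o| = 1 → |σ| = 1 →
        ν (sector x₁ ![o * ρ, o * ρ * (l₁ + r)] ![0, σ] δ (Ico 0 ε)) < ∞ := by
      intro r
      obtain ⟨ρ, hρ, hr⟩ := hHs r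
      obtain ⟨δ, hδ, ε, hε, hA, hB, hC, hD⟩ := exists_of_eventually₄ (hr 1 1 h1 h1)
        (hr 1 (-1) h1 hm1) (hr (-1) 1 hm1 h1) (hr (-1) (-1) hm1 hm1)
      refine ⟨ρ, hρ, δ, hδ, ε, hε, fun o σ ho hσ => ?_⟩
      rw [hν]
      rcases hpm o ho with rfl | rfl <;> rcases hpm σ hσ with rfl | rfl
      exacts [hA, hB, hC, hD]
    obtain ⟨V, hVo, hVx, hVν⟩ := cover_nhds ν x₁ hν0 l₁ hδV hεV hV hHor
    exact ⟨V, hVo, hVx, by rwa [hν] at hVν⟩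
  by_cases hpole : x₁ 1 - (l₁ * x₁ 0 + l₂) = 0
  · -- at a point of the pole line
    refine ⟨fun p q hp hq => ?_, fun r => ?_⟩
    · exact vsector_pole_ev M lo hi a N N' cc E n W₁ l₁ l₂ x₁ R Ri hpole hR' hRi' hRm hRim hW₁c hW₁0
        hρW hWb hfinY hp hq _ _ rfl rfl
    · rcases eq_or_ne r 0 with rfl | hr
      · refine ⟨1, one_pos, fun o σ ho hσ => ?_⟩
        refine hsector_pole_ev M lo hi a N N' cc E n W₁ l₁ l₂ x₁ R Ri hpole hR' hRi' hRm hRim hW₁c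
          hW₁0 hρW hWb hfinY (P₀ := o) (s := 0) (sigma_ne_zero ho) hσ (Or.inl rfl) _ _ ?_ rfl
        simp
      · have hr0 : 0 < |r| := abs_pos.2 hr
        refine ⟨|r|⁻¹, inv_pos.2 hr0, fun o σ ho hσ => ?_⟩
        refine hsector_pole_ev M lo hi a N N' cc E n W₁ l₁ l₂ x₁ R Ri hpole hR' hRi' hRm hRim hW₁c
          hW₁0 hρW hWb hfinY (P₀ := o * |r|⁻¹) (s := o * |r|⁻¹ * r)
          (mul_ne_zero (sigma_ne_zero ho) (inv_ne_zero hr0.ne')) hσ (Or.inr ⟨?_, ?_⟩) _ _ ?_ rfl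
        · exact mul_ne_zero (mul_ne_zero (sigma_ne_zero ho) (inv_ne_zero hr0.ne')) hr
        · rw [abs_mul, abs_mul, ho, abs_inv, abs_abs, one_mul, inv_mul_cancel₀ hr0.ne']
          norm_num
        · rw [mul_add]
  · -- off the pole line: no letter vanishes at `x₁`
    have hE : E = 0 := by
      by_contra h
      obtain ⟨j, hj0, hej⟩ := hEj h
      exact hpole (hH j hej hj0)
    have hR'' : ∀ x, R x = (∑ i ∈ Finset.range N, (∑ m ∈ Finset.range N', cc (i, m) * (x 0 - x₁ 0) ^ m) *
        (x 1 - (l₁ * x 0 + l₂)) ^ i) / (W₁ (x 0 - x₁ 0) * (x 1 - (l₁ * x 0 + l₂)) ^ n) := fun x => by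
      rw [hR' x, hE, pow_zero, one_mul]
    have hRi'' : ∀ i ∈ Finset.range N, ∀ x, Ri i x = (∑ m ∈ Finset.range N', cc (i, m) * (x 0 - x₁ 0) ^ m) *
        (x 1 - (l₁ * x 0 + l₂)) ^ i / (W₁ (x 0 - x₁ 0) * (x 1 - (l₁ * x 0 + l₂)) ^ n) := fun i hi x => by
      rw [hRi' i hi x, hE, pow_zero, one_mul]
    refine ⟨fun p q hp hq => ?_, fun r => ⟨1, one_pos, fun o σ ho hσ => ?_⟩⟩
    · exact vsector_away_ev M lo hi a N N' cc n W₁ l₁ l₂ x₁ R Ri hpole hcc hR'' hRi'' hRm hRim hW₁c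
        hW₁0 hρW hρW1 hWb hfinY hp hq _ _ rfl rfl
    · refine hsector_away_ev M lo hi a N N' cc n W₁ l₁ l₂ x₁ R Ri hpole hcc hR'' hRi'' hRm hRim hW₁c
        hW₁0 hρW hρW1 hWb hfinY (P₀ := o) (s := o * r) (sigma_ne_zero ho) hσ _ _ ?_ rfl
      simp only [mul_one, mul_add]

end SepTwo

/-- **Local finiteness of the Taylor-piece density at a base point** (registered part of
`stub_separateTwoPos_hI`; restatement of `SepTwo.local_finite`): see the module docstring. -/
theorem separateTwo_hiLocal {k m m' : ℕ} (M : Fin m' → SepTwo.Atm 2) (lo hi : Fin k → Fin k ⊕ SepTwo.Atm 2) (a : Fin k → Option (SepTwo.Atm 2)) (κ μ : Fin m → ℝ) (e : Fin m → ℕ) (n : ℕ) (l₁ l₂ : ℝ) (N : ℕ) (q : ℕ → MvPolynomial (Fin 1) ℚ) (R : (Fin 2 → ℝ) → ℝ) (Ri : ℕ → (Fin 2 → ℝ) → ℝ) (hR : ∀ x, R x = (∑ i ∈ Finset.range N, MvPolynomial.aeval (fun _ : Fin 1 => x 0) (q i) * (x 1 - (l₁ * x 0 + l₂)) ^ i)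 / ((∏ j, (κ j * x 0 + μ j) ^ e j) * (x 1 - (l₁ * x 0 + l₂)) ^ n)) (hRi : ∀ i ∈ Finset.range N, ∀ x, Ri i x = MvPolynomial.aeval (fun _ : Fin 1 => x 0) (q i) * (x 1 - (l₁ * x 0 + l₂)) ^ i / ((∏ j, (κ j * x 0 + μ j) ^ e j) * (x 1 - (l₁ * x 0 + l₂)) ^ n)) (hRm : Measurable R) (hRim : ∀ i, Measurable (Ri i)) (hκ : ∀ j, e j ≠ 0 → κ j = 0 → μ j ≠ 0) (hfinY : MeasureTheory.lintegral (MeasureTheory.volume.restrict {x | ∀ j, 0 < SepTwo.av x (M j)}) (fun x => ENNReal.ofReal |R x| * SepTwo.lmass lo hi a (SepTwo.av x)) < ⊤) (x₁ : Fin 2 → ℝ) (hH : ∀ j, e j ≠ 0 → κ j * x₁ 0 + μ j = 0 → x₁ 1 - (l₁ * x₁ 0 + l₂) = 0) : ∃ V : Set (Fin 2 → ℝ), IsOpen V ∧ x₁ ∈ V ∧ MeasureTheory.lintegral (MeasureTheory.volume.restrict V) (fun z => {x : Fin 2 → ℝ | ∀ j, 0 < SepTwo.av x (M j)}.indicator (fun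 x => (∑ i ∈ Finset.range N, ENNReal.ofReal |Ri i x|) * SepTwo.lmass lo hi a (SepTwo.av x)) z) < ⊤ := by
  exact SepTwo.local_finite M lo hi a κ μ e n l₁ l₂ N q R Ri hR hRi hRm hRim hκ hfinY x₁ hH

end Summit.KontsevichZagierPeriods.ArrangementNormalForm.JanusBands
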